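import Literature.NumberTheory.Irrationality.Fischler2002.Theoreme32OrderTwoProofs
import Literature.NumberTheory.Irrationality.RhinViola2001.PermutationGroupOrder
import HarnessLib

/-!
# Fischler 2002, Théorème 3.2 — brick III: for `n = 3` the group `⟨σ, ψ, φ⟩` has order `1920` (it IS Rhin–Viola's `Φ`)

Topic `Literature/NumberTheory/Irrationality/Fischler2002`. PROOFS ONLY (no definition, no statement, no discharge): third brick
toward the named fact `theoreme32` of `RhinViolaGroupsGeneral.lean` —

> [Fischler2002Polyzetas, §3 Théorème 3.2] « Pour `n = 3`, le groupe `G` est isomorphe à `H ⋊ 𝔖₅`, où `H` est l'hyperplan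
> `ε₁ + … + ε₅ = 0` de `(ℤ/2ℤ)⁵` ; il laisse stable `𝒥(p)/(a₁! a₂! a₃! b₁! b₂! b₃! (a₂+b₃−c₃)! (b₁+b₃−c₃)!)` »
> (`paper:arxiv-math_0202064` p. 4; [Fischler2003RhinViola, §3.4 Th. 6: « donc d'ordre 1920 »]; the note adds that for `n = 3`
> the change of variables of Théorème 2.1 turns `G` into the Rhin–Viola group of [RhinViola2001]).

For `n = 3` (`𝓔 = {c₂ = 0, a₁ + b₂ = a₃ + b₃}`) we prove `Nat.card ⟨σ', ψ', φ'⟩ = 1920 = rvGroupOrder 3` for ANY permutations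
`σ', ψ', φ'` of `{p // InE 3 p}` with underlying maps `sigma`, `psi 3`, `phi 3` (`card_closure_eq_three`). ROUTE (the seat's
reconnaissance `HOME/ct-1/g33/THEOREME32-RECON.md` + the tree's PROVED Rhin–Viola files): on `𝓔` the group PERMUTES the TEN SUMS
`u₀ = a₂+b₂, u₁ = b₁+b₃, u₂ = a₁+b₂, u₃ = a₁+b₁, u₄ = a₁+b₁+b₃−c₃, u₅ = a₁+a₂+b₂−c₃, u₆ = a₂+b₁+b₃−c₃, u₇ = a₂+b₂+b₃−c₃,
u₈ = a₁+b₁+b₂−c₃, u₉ = a₂+b₃` (pairs `{u₀,u₄}, {u₁,u₅}, {u₂,u₆}, {u₃,u₇}, {u₈,u₉}` of constant sum `a₁+a₂+b₁+b₂+b₃−c₃`),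
numbered so that the pairs ARE the blocks `P` of `RhinViola2001/TenSumsPermutations.lean`; `σ, ψ, φ` act through the even
block-preserving permutations `(0 3)(1 9)(4 7)(5 8)`, `(0 9)(1 7)(3 5)(4 8)`, `(1 6)(2 5)`, i.e. through elements of Rhin–Viola's
`Φ` (`PhiGroup.mem_Phi_iff`); the induced map `ρ : ⟨σ',ψ',φ'⟩ →* Perm (Fin 10)` is an INJECTIVE homomorphism (the ten sums have
rank 6 = rank 𝓔₃; the other coordinates are inert) whose range is EXACTLY `Φ` (Rhin–Viola's generators are the words
`ϑ = σφσφψφσψ`, `ϕ = ψσψφψσψ` in ours), so `|⟨σ',ψ',φ'⟩| = |Φ| = 1920` by the tree's `PhiGroup.card_Phi` (RhinViola2001 §4,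
PROVED there without enumeration). The sums ride on a FREE function symbol `u` with its defining table (no definition introduced).
Cell `pub-zeta5`, seat ct-1 g33, 2026-08-27/28.

HONEST FRAMING (cell pub-zeta5): systematic search; no irrationality claim unless certified — pure bookkeeping of a printed group
structure (the identification of Fischler's `n = 3` group with the Rhin–Viola group for `ζ(3)` as permutation groups of ten sums);
nothing about `ζ(5)`.
-/

namespace Literature.NumberTheory.Irrationality.Fischler2002

namespace Theoreme32

open Equiv RhinViola2001

section OrderThree

variable {u : Fin 10 → Exponents → ℤ}
  (hu : ∀ (x : Fin 10) (p : Exponents), u x p =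
    ![p.a 2 + p.b 2, p.b 1 + p.b 3, p.a 1 + p.b 2, p.a 1 + p.b 1, p.a 1 + p.b 1 + p.b 3 - p.c 3,
      p.a 1 + p.a 2 + p.b 2 - p.c 3, p.a 2 + p.b 1 + p.b 3 - p.c 3, p.a 2 + p.b 2 + p.b 3 - p.c 3,
      p.a 1 + p.b 1 + p.b 2 - p.c 3, p.a 2 + p.b 3] x)
  {gσ gψ gφ : Perm {p : Exponents // InE 3 p}}

/-! ### The ten sums and the action of the generators -/

include hu in
/-- `σ` acts on the ten sums through `(0 3)(1 9)(4 7)(5 8)`. [cite: Fischler2002Polyzetas, §3 Théorème 3.2 (n = 3)] -/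
theorem rel3_sigma (hσ : ∀ p, (gσ p).1 = sigma p.1) (x : Fin 10) (p : {p : Exponents // InE 3 p}) :
    u x (gσ p).1 = u ((swap (0 : Fin 10) 3 * swap (1 : Fin 10) 9 * swap (4 : Fin 10) 7 * swap (5 : Fin 10) 8) x) p.1 := by
  obtain ⟨-, h3, -⟩ := p.2
  have e := h3 rfl
  rw [hσ p]
  fin_cases x <;> simp [hu, sigma, Equiv.swap_apply_def] <;> linarith

include hu in
/-- `ψ` acts on the ten sums through `(0 9)(1 7)(3 5)(4 8)`. [cite: Fischler2002Polyzetas, §3 Théorème 3.2 (n = 3)] -/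
theorem rel3_psi (hψ : ∀ p, (gψ p).1 = psi 3 p.1) (x : Fin 10) (p : {p : Exponents // InE 3 p}) :
    u x (gψ p).1 = u ((swap (0 : Fin 10) 9 * swap (1 : Fin 10) 7 * swap (3 : Fin 10) 5 * swap (4 : Fin 10) 8) x) p.1 := by
  obtain ⟨-, h3, -⟩ := p.2
  have e := h3 rfl
  rw [hψ p]
  fin_cases x <;> simp [hu, psi, Equiv.swap_apply_def] <;> linarith

include hu in
/-- `φ` acts on the ten sums through `(1 6)(2 5)`. [cite: Fischler2002Polyzetas, §3 Théorème 3.2 (n = 3)] -/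
theorem rel3_phi (hφ : ∀ p, (gφ p).1 = phi 3 p.1) (x : Fin 10) (p : {p : Exponents // InE 3 p}) :
    u x (gφ p).1 = u ((swap (1 : Fin 10) 6 * swap (2 : Fin 10) 5) x) p.1 := by
  obtain ⟨-, h3, -⟩ := p.2
  have e := h3 rfl
  rw [hφ p]
  fin_cases x <;> simp [hu, phi, Equiv.swap_apply_def] <;> linarith

/-! ### The relation «`g` acts on the sums through `π`» is multiplicative -/

/-- Products (an anti-homomorphism). [cite: Fischler2002Polyzetas, §3 Théorème 3.2 (n = 3)] -/
theorem rel3_mul {g h : Perm {p : Exponents // InE 3 p}} {π τ : Perm (Fin 10)}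
    (hg : ∀ x p, u x (g p).1 = u (π x) p.1) (hh : ∀ x p, u x (h p).1 = u (τ x) p.1) :
    ∀ x p, u x ((g * h) p).1 = u ((τ * π) x) p.1 := by
  intro x p
  rw [Perm.mul_apply, hg, hh, Perm.mul_apply]

/-- Inverses. [cite: Fischler2002Polyzetas, §3 Théorème 3.2 (n = 3)] -/
theorem rel3_inv {g : Perm {p : Exponents // InE 3 p}} {π : Perm (Fin 10)} (hg : ∀ x p, u x (g p).1 = u (π x) p.1) :
    ∀ x p, u x (g⁻¹ p).1 = u (π⁻¹ x) p.1 := by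
  intro x p
  have h := hg (π⁻¹ x) (g⁻¹ p)
  simp only [Perm.coe_inv, Equiv.apply_symm_apply] at h ⊢
  exact h.symm

include hu in
/-- **Every element of `⟨σ', ψ', φ'⟩` acts on the ten sums through some `π` in Rhin–Viola's `Φ`** (the three generating
permutations are block-preserving for `P` and even — `PhiGroup.mem_Phi_iff`). [cite: Fischler2002Polyzetas, §3 Théorème 3.2 (n = 3)]
[cite: RhinViola2001, §4 p. 282 (Φ, P)] -/
theorem exists_rel3_of_mem (hσ : ∀ p, (gσ p).1 = sigma p.1) (hψ : ∀ p, (gψ p).1 = psi 3 p.1)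
    (hφ : ∀ p, (gφ p).1 = phi 3 p.1) {g : Perm {p : Exponents // InE 3 p}}
    (hg : g ∈ Subgroup.closure ({gσ, gψ, gφ} : Set (Perm {p : Exponents // InE 3 p}))) :
    ∃ π : Perm (Fin 10), π ∈ PhiGroup.Phi ∧ ∀ x p, u x (g p).1 = u (π x) p.1 := by
  induction hg using Subgroup.closure_induction with
  | mem x hx =>
    simp only [Set.mem_insert_iff, Set.mem_singleton_iff] at hx
    rcases hx with rfl | rfl | rfl
    · exact ⟨_, (PhiGroup.mem_Phi_iff _).2 ⟨by unfold PhiGroup.BlockPreserving; decide, by decide⟩, rel3_sigma hu hσ⟩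
    · exact ⟨_, (PhiGroup.mem_Phi_iff _).2 ⟨by unfold PhiGroup.BlockPreserving; decide, by decide⟩, rel3_psi hu hψ⟩
    · exact ⟨_, (PhiGroup.mem_Phi_iff _).2 ⟨by unfold PhiGroup.BlockPreserving; decide, by decide⟩, rel3_phi hu hφ⟩
  | one => exact ⟨1, PhiGroup.Phi.one_mem, fun x p => rfl⟩
  | mul x y _ _ ihx ihy =>
    obtain ⟨π, hπ, hx⟩ := ihx
    obtain ⟨τ, hτ, hy⟩ := ihy
    exact ⟨τ * π, PhiGroup.Phi.mul_mem hτ hπ, rel3_mul hx hy⟩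
  | inv x _ ihx =>
    obtain ⟨π, hπ, hx⟩ := ihx
    exact ⟨π⁻¹, PhiGroup.Phi.inv_mem hπ, rel3_inv hx⟩

/-! ### The inert coordinates are fixed -/

/-- Every element of `⟨σ', ψ', φ'⟩` (`n = 3`) fixes the coordinates other than `a₁,a₂,a₃,b₁,b₂,b₃,c₂,c₃`.
[cite: Fischler2002Polyzetas, §3 Théorème 3.2 (n = 3)] -/
theorem inert3_of_mem (hσ : ∀ p, (gσ p).1 = sigma p.1) (hψ : ∀ p, (gψ p).1 = psi 3 p.1)
    (hφ : ∀ p, (gφ p).1 = phi 3 p.1) {g : Perm {p : Exponents // InE 3 p}}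
    (hg : g ∈ Subgroup.closure ({gσ, gψ, gφ} : Set (Perm {p : Exponents // InE 3 p}))) (p : {p : Exponents // InE 3 p}) :
    (∀ k, k ≠ 1 → k ≠ 2 → k ≠ 3 → (g p).1.a k = p.1.a k) ∧ (∀ k, k ≠ 1 → k ≠ 2 → k ≠ 3 → (g p).1.b k = p.1.b k) ∧
      (∀ k, k ≠ 2 → k ≠ 3 → (g p).1.c k = p.1.c k) := by
  induction hg using Subgroup.closure_induction generalizing p with
  | mem x hx =>
    simp only [Set.mem_insert_iff, Set.mem_singleton_iff] at hx
    rcases hx with rfl | rfl | rfl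
    · rw [hσ p]
      refine ⟨fun k h1 h2 _ => ?_, fun k h1 h2 _ => ?_, fun k _ _ => rfl⟩ <;> simp [sigma, h1, h2]
    · rw [hψ p]
      refine ⟨fun k h1 h2 h3 => ?_, fun k h1 h2 h3 => ?_, fun k h2 h3 => ?_⟩ <;> simp [psi] <;> omega
    · rw [hφ p]
      refine ⟨fun k _ h2 _ => ?_, fun k _ h2 h3 => ?_, fun k _ h3 => ?_⟩
      · simp [phi, h2]
      · simp [phi, h2, h3]
      · simp [phi, h3]
  | one => exact ⟨fun k _ _ _ => rfl, fun k _ _ _ => rfl, fun k _ _ => rfl⟩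
  | mul x y _ _ ihx ihy =>
    obtain ⟨ha, hb, hc⟩ := ihx (y p)
    obtain ⟨ha', hb', hc'⟩ := ihy p
    refine ⟨fun k h1 h2 h3 => ?_, fun k h1 h2 h3 => ?_, fun k h2 h3 => ?_⟩
    · rw [Perm.mul_apply, ha k h1 h2 h3, ha' k h1 h2 h3]
    · rw [Perm.mul_apply, hb k h1 h2 h3, hb' k h1 h2 h3]
    · rw [Perm.mul_apply, hc k h2 h3, hc' k h2 h3]
  | inv x _ ihx =>
    obtain ⟨ha, hb, hc⟩ := ihx (x⁻¹ p)
    simp only [Perm.coe_inv, Equiv.apply_symm_apply] at ha hb hc ⊢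
    exact ⟨fun k h1 h2 h3 => (ha k h1 h2 h3).symm, fun k h1 h2 h3 => (hb k h1 h2 h3).symm,
      fun k h2 h3 => (hc k h2 h3).symm⟩

/-! ### Faithfulness -/

include hu in
/-- **Faithfulness (`n = 3`).** An element of `⟨σ', ψ', φ'⟩` fixing the ten sums is the identity: the ten sums have rank
`6 = rank 𝓔₃` (the coordinates `a₁,a₂,a₃,b₁,b₂,b₃,c₃` are rational combinations of them and of the relation
`a₁ + b₂ = a₃ + b₃`), `c₂ = 0` on `𝓔`, and the other coordinates are inert. [cite: Fischler2002Polyzetas, §3 Théorème 3.2 (n = 3)] -/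
theorem eq_one_of_rel3_one (hσ : ∀ p, (gσ p).1 = sigma p.1) (hψ : ∀ p, (gψ p).1 = psi 3 p.1)
    (hφ : ∀ p, (gφ p).1 = phi 3 p.1) {g : Perm {p : Exponents // InE 3 p}}
    (hg : g ∈ Subgroup.closure ({gσ, gψ, gφ} : Set (Perm {p : Exponents // InE 3 p})))
    (h1 : ∀ x p, u x (g p).1 = u x p.1) : g = 1 := by
  refine Equiv.ext fun p => Subtype.ext ?_
  rw [Perm.one_apply]
  obtain ⟨ha, hb, hc⟩ := inert3_of_mem hσ hψ hφ hg p
  obtain ⟨hc0, hrel, -⟩ := p.2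
  obtain ⟨hc0', hrel', -⟩ := (g p).2
  have e := hrel rfl
  have e' := hrel' rfl
  have c2 := hc0 2 le_rfl (by norm_num)
  have c2' := hc0' 2 le_rfl (by norm_num)
  have f := fun x => h1 x p
  have f0 := f 0; have f1 := f 1; have f2 := f 2; have f3 := f 3; have f4 := f 4
  have f5 := f 5; have f6 := f 6; have f7 := f 7; have f8 := f 8; have f9 := f 9
  simp only [hu] at f0 f1 f2 f3 f4 f5 f6 f7 f8 f9
  simp only [Matrix.cons_val] at f0 f1 f2 f3 f4 f5 f6 f7 f8 f9
  refine exponents_eq (fun k => ?_) (fun k => ?_) (fun k => ?_)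
  · by_cases hk1 : k = 1
    · subst hk1; linarith
    · by_cases hk2 : k = 2
      · subst hk2; linarith
      · by_cases hk3 : k = 3
        · subst hk3; linarith
        · exact ha k hk1 hk2 hk3
  · by_cases hk1 : k = 1
    · subst hk1; linarith
    · by_cases hk2 : k = 2
      · subst hk2; linarith
      · by_cases hk3 : k = 3
        · subst hk3; linarith
        · exact hb k hk1 hk2 hk3
  · by_cases hk2 : k = 2
    · subst hk2; rw [c2, c2']
    · by_cases hk3 : k = 3
      · subst hk3; linarith
      · exact hc k hk2 hk3

/-! ### The permutation `π` is unique: the ten sums are pairwise distinct -/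

include hu in
/-- **Uniqueness of `π` (`n = 3`).** At the point `(a₁,a₂,a₃,b₁,b₂,b₃,c₃) = (1,10,100,1000,10000,9901,100000)` of `𝓔` the ten sums
take ten distinct values. [cite: Fischler2002Polyzetas, §3 Théorème 3.2 (n = 3)] -/
theorem rel3_unique {g : Perm {p : Exponents // InE 3 p}} {π π' : Perm (Fin 10)}
    (hπ : ∀ x p, u x (g p).1 = u (π x) p.1) (hπ' : ∀ x p, u x (g p).1 = u (π' x) p.1) : π = π' := by
  let p₀ : {p : Exponents // InE 3 p} :=
    ⟨⟨fun k => if k = 1 then 1 else if k = 2 then 10 else if k = 3 then 100 else 0,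
      fun k => if k = 1 then 1000 else if k = 2 then 10000 else if k = 3 then 9901 else 0,
      fun k => if k = 3 then 100000 else 0⟩,
      fun k hk hk' => by simp only; rw [if_neg (by omega)], fun _ => by simp, fun h => by omega⟩
  have hv : ∀ x : Fin 10, u x p₀.1 =
      ![(10010 : ℤ), 10901, 10001, 1001, -89098, -89989, -89089, -80089, -88999, 9911] x := by
    intro x
    fin_cases x <;> simp [hu, p₀]
  have hinj : Function.Injective
      (![(10010 : ℤ), 10901, 10001, 1001, -89098, -89989, -89089, -80089, -88999, 9911] : Fin 10 → ℤ) := by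
    decide
  ext x : 1
  have e := (hπ x p₀).symm.trans (hπ' x p₀)
  rw [hv, hv] at e
  exact hinj e

/-! ### The order `1920` -/

include hu in
/-- **For `n = 3`, `|⟨σ', ψ', φ'⟩| = 1920`**, via the injective homomorphism `ρ : g ↦ π_g⁻¹` to `Perm (Fin 10)` whose range is
Rhin–Viola's `Φ` (`⊆`: generators block-preserving and even; `⊇`: `ϑ = ρ(σ'φ'σ'φ'ψ'φ'σ'ψ')`, `ϕ = ρ(ψ'σ'ψ'φ'ψ'σ'ψ')` and
`Φ = ⟨ϕ, ϑ⟩`, `PhiGroup.Phi_eq_PhiTwo`), and `PhiGroup.card_Phi`. [cite: Fischler2002Polyzetas, §3 Théorème 3.2 (n = 3)]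
[cite: RhinViola2001, §4 pp. 283–284 (|Φ| = 1920, Φ = ⟨ϕ, ϑ⟩)] -/
theorem card_closure_eq_three_aux (hσ : ∀ p, (gσ p).1 = sigma p.1) (hψ : ∀ p, (gψ p).1 = psi 3 p.1)
    (hφ : ∀ p, (gφ p).1 = phi 3 p.1) :
    Nat.card (Subgroup.closure ({gσ, gψ, gφ} : Set (Perm {p : Exponents // InE 3 p}))) = 1920 := by
  set G := Subgroup.closure ({gσ, gψ, gφ} : Set (Perm {p : Exponents // InE 3 p})) with hG
  have hex : ∀ g : G, ∃ π : Perm (Fin 10), π ∈ PhiGroup.Phi ∧ ∀ x p, u x (g.1 p).1 = u (π x) p.1 :=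
    fun g => exists_rel3_of_mem hu hσ hψ hφ g.2
  choose πf hπΦ hπf using hex
  let ρ : G →* Perm (Fin 10) :=
    { toFun := fun g => (πf g)⁻¹
      map_one' := by
        have h1 : ∀ x p, u x ((1 : G).1 p).1 = u ((1 : Perm (Fin 10)) x) p.1 := fun x p => rfl
        rw [rel3_unique hu (hπf 1) h1, inv_one]
      map_mul' := fun g h => by
        have hm := rel3_mul (hπf g) (hπf h)
        rw [← mul_inv_rev, ← rel3_unique hu (hπf (g * h)) hm] }
  have hρ : ∀ g : G, ρ g = (πf g)⁻¹ := fun g => rfl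
  -- injective
  have hinj : Function.Injective ρ := by
    refine (injective_iff_map_eq_one ρ).2 fun g hg => ?_
    rw [hρ, inv_eq_one] at hg
    have h1 : ∀ x p, u x (g.1 p).1 = u x p.1 := by
      intro x p
      rw [hπf g x p, hg, Perm.one_apply]
    exact Subtype.ext (eq_one_of_rel3_one hu hσ hψ hφ g.2 h1)
  -- the generators' images
  have hσmem : gσ ∈ G := Subgroup.subset_closure (by simp)
  have hψmem : gψ ∈ G := Subgroup.subset_closure (by simp)
  have hφmem : gφ ∈ G := Subgroup.subset_closure (by simp)
  have eσ : ρ ⟨gσ, hσmem⟩ = swap (0 : Fin 10) 3 * swap (1 : Fin 10) 9 * swap (4 : Fin 10) 7 * swap (5 : Fin 10) 8 := by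
    rw [hρ, rel3_unique hu (hπf ⟨gσ, hσmem⟩) (rel3_sigma hu hσ)]; decide
  have eψ : ρ ⟨gψ, hψmem⟩ = swap (0 : Fin 10) 9 * swap (1 : Fin 10) 7 * swap (3 : Fin 10) 5 * swap (4 : Fin 10) 8 := by
    rw [hρ, rel3_unique hu (hπf ⟨gψ, hψmem⟩) (rel3_psi hu hψ)]; decide
  have eφ : ρ ⟨gφ, hφmem⟩ = swap (1 : Fin 10) 6 * swap (2 : Fin 10) 5 := by
    rw [hρ, rel3_unique hu (hπf ⟨gφ, hφmem⟩) (rel3_phi hu hφ)]; decide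
  -- the range is Rhin–Viola's `Φ`
  have hrange : ρ.range = PhiGroup.Phi := by
    refine le_antisymm ?_ ?_
    · rintro _ ⟨g, rfl⟩
      rw [hρ]
      exact PhiGroup.Phi.inv_mem (hπΦ g)
    · rw [PhiGroup.Phi_eq_PhiTwo, PhiGroup.PhiTwo, Subgroup.closure_le]
      rintro x hx
      simp only [Set.mem_insert_iff, Set.mem_singleton_iff] at hx
      rcases hx with rfl | rfl
      · -- `ϕ = ρ(ψ'σ'ψ'φ'ψ'σ'ψ')`
        refine ⟨⟨gψ, hψmem⟩ * ⟨gσ, hσmem⟩ * ⟨gψ, hψmem⟩ * ⟨gφ, hφmem⟩ * ⟨gψ, hψmem⟩ * ⟨gσ, hσmem⟩ * ⟨gψ, hψmem⟩, ?_⟩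
        simp only [map_mul, eσ, eψ, eφ]
        decide +kernel
      · -- `ϑ = ρ(σ'φ'σ'φ'ψ'φ'σ'ψ')`
        refine ⟨⟨gσ, hσmem⟩ * ⟨gφ, hφmem⟩ * ⟨gσ, hσmem⟩ * ⟨gφ, hφmem⟩ * ⟨gψ, hψmem⟩ * ⟨gφ, hφmem⟩ * ⟨gσ, hσmem⟩ *
          ⟨gψ, hψmem⟩, ?_⟩
        simp only [map_mul, eσ, eψ, eφ]
        decide +kernel
  rw [Nat.card_congr (MonoidHom.ofInjective hinj).toEquiv, hrange]
  exact PhiGroup.card_Phi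

end OrderThree

/-- **Fischler's Théorème 3.2 for `n = 3`, the ORDER: `|⟨σ', ψ', φ'⟩| = 1920 = rvGroupOrder 3`** for any permutations `σ', ψ', φ'` of
`{p // p ∈ 𝓔}` with underlying maps `sigma`, `psi 3`, `phi 3` (they exist: `exists_perms`). The typed isomorphism type `H ⋊ 𝔖₅` is
realised as Rhin–Viola's permutation group `Φ` of the ten sums (`card_closure_eq_three_aux`).
[cite: Fischler2002Polyzetas, §3 Théorème 3.2 (n = 3)] [cite: Fischler2003RhinViola, §3.4 Théorème 6 p. 515] -/
theorem card_closure_eq_three {gσ gψ gφ : Perm {p : Exponents // InE 3 p}} (hσ : ∀ p, (gσ p).1 = sigma p.1)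
    (hψ : ∀ p, (gψ p).1 = psi 3 p.1) (hφ : ∀ p, (gφ p).1 = phi 3 p.1) :
    Nat.card (Subgroup.closure ({gσ, gψ, gφ} : Set (Perm {p : Exponents // InE 3 p}))) = rvGroupOrder 3 := by
  obtain ⟨u, hu⟩ : ∃ u : Fin 10 → Exponents → ℤ, ∀ (x : Fin 10) (p : Exponents), u x p =
      ![p.a 2 + p.b 2, p.b 1 + p.b 3, p.a 1 + p.b 2, p.a 1 + p.b 1, p.a 1 + p.b 1 + p.b 3 - p.c 3,
        p.a 1 + p.a 2 + p.b 2 - p.c 3, p.a 2 + p.b 1 + p.b 3 - p.c 3, p.a 2 + p.b 2 + p.b 3 - p.c 3,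
        p.a 1 + p.b 1 + p.b 2 - p.c 3, p.a 2 + p.b 3] x := ⟨_, fun _ _ => rfl⟩
  rw [card_closure_eq_three_aux hu hσ hψ hφ, rvGroupOrder, if_neg (by norm_num), if_pos rfl]

end Theoreme32

end Literature.NumberTheory.Irrationality.Fischler2002
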